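import Summits.CriticalPhenomena.PercolationContinuityZ3.Theorems.PercNearOneGluingNoHeavyQuantSGCCellMembers
import HarnessLib

/-!
# QUANT lane R8, Route 1 (`SingleGateConvClosed`), row certificates: the COLUMN BOUND at a high atom of the certified factor —
# in the `μ₂`-averaged dual the averaged product price at an atom `a` with `τ₁ ≤ 2a` is at most the zero's price gap `(1−q)·(φ 0 − φ⁺(a))`

builds on p205010 (kernel theorem, internal audit signed; external expert review pending)

Support file (`--supports stmt-CriticalPhenomena-4575`), QUANT lane seat prim-quant-arm-2 (gen 43), rung R8 of
`run/shared/lean/prim/quant/LADDER.md`; memo `run/shared/lean/prim/quant/prim-quant-arm-2-g43/ROWCERT-G43.md` §3.3.  One theorem, standard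
axioms, no sorries, no definitions.  Companion of `…QuantSGCRowCertificate` (✓ p425588: `sum_test_nonpos_of_rowCert`,
`decAt_gate_lconv_of_rowMembers` — the `μ₂`-averaged certificate `c̄(a) = Σ_k μ₂ k·(q·φ(a+k) + (1−q)·φ 0) ≤ Σ members + λ(a−T₁) + σ` on the atoms
`a` of the certified factor) and of arm-2 g42's `…QuantSGCCellMembers` (`pullback_valid`, `sum_priceVec_gate_nonpos`).

WHY.  In the averaged certificate the column (second-factor) members disappear — averaged against `μ₂` they are nonpositive constants — but the
second factor's admissibility still bounds the TARGET `c̄`: at every atom `a` of the first factor that is HIGH for the first target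
(`τ₁ ≤ 2a`, `1 ≤ a ≤ j`), the product price system pulled back along the column `k ↦ a + k` is a valid price system of `gate μ₂ q` at layer
`j − a` (arm-2 g37's vertical transport; `pullback_valid` with the roles of the factors exchanged: rates only improve because `τ₁ ≤ 2a`), so its
weak-duality sum is `≤ 0`, and it dominates the averaged price term by term except for the gate zero's share.  Hence
`c̄(a) ≤ (1−q)·(φ 0 − φ⁺(a))` (`φ⁺(a) = α a` if `a` is a product low, else `0`); for `q = 1`, `c̄(a) ≤ 0` at every high atom.  So in the averaged
dual of `SingleGateConvClosed` the whole difficulty sits at the LOW atoms of the certified factor plus these zero-price gaps — the dual reading of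
"the doubly-low block and the gate zero" (arm-2 g37 L2-TRANSPORT §8–§9, census-2 g62 §12); the row members must not claim, at such atoms, the
giants that this column bound already spends (memo §3.4: the single failure mode of the explicit natural certificate).

* **`LawDec.rowAvg_le_at_highAtom`** — the bound above.
HONEST STATUS: `SingleGateConvClosed` OPEN; structural lemma for its dual route; RATE class log\* / honest sentence unchanged.

[this work]; vertical transport: prim-quant-arm-2 g37; `pullback_valid` / members: prim-quant-arm-2 g42; weak duality: prim-quant-stmt g22 (this lane).
The gluing rows served [cite: KozmaNitzan2024, Conjecture 3 (p. 15)]; product measure [cite: Grimmett1999, §1.3 p. 10].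
-/

noncomputable section

namespace Summit.CriticalPhenomena.PercolationContinuityZ3.Theorems

namespace Quant

open Finset

namespace LawDec

/-- the price vector of a price system (local notation, as in `…QuantSGCCellMembers`). -/
local notation3 "PV[" T ", " L ", " α ", " β ", " h "]" =>
  (if (h : ℕ) ≤ (L : ℕ) ∧ 2 * ((h : ℕ) : ℝ) < (T : ℝ) then (α : ℕ → ℝ) h else -(β : ℕ → ℝ) h)

/-! ### The column bound at a high atom of the certified factor -/

/-- **THE AVERAGED PRICE AT A HIGH ATOM IS AT MOST THE ZERO'S PRICE GAP** (arm-2 g37's vertical transport, dual form, inside the row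
certificate).  Let `0 < y < 1`, `0 ≤ q ≤ 1`, `μ₂ ≥ 0` a law of mass `1` on `{0..M₂}` (vanishing above `M₂`) with `gate μ₂ q` DEC at layer `j − a`
at a target `τ₂ > 0`, and `(α, β)` a price system of the product structure `(y, τ₁ + τ₂, j, M₁ + M₂)`.  If the atom `a` is HIGH for the first
target (`τ₁ ≤ 2a`) with `1 ≤ a ≤ j`, `a ≤ M₁`, then the `μ₂`-averaged product price at `a` satisfies
`Σ_{k ≤ M₂} μ₂ k·(q·φ(a+k) + (1−q)·φ 0) ≤ (1−q)·(φ 0 − φ⁺(a))` with `φ = PV[τ₁+τ₂, j, α, β`, ] and `φ⁺(a) = α a` if `2a < τ₁+τ₂` (then `a` is a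
product low), else `0`.  Proof: the pullback `k ↦ φ(a+k)` of the product system along the column `a` is a valid price system of `gate μ₂ q`
at layer `j − a` (`pullback_valid`, rates improve because `τ₁ ≤ 2a`), its weak-duality sum is `≤ 0` (`sum_priceVec_gate_nonpos`), and it
dominates the averaged price term by term except for the zero's share `(1−q)·(φ 0 − φ⁺(a))`.  For `q = 1` the bound is `0`. [this work] -/
theorem rowAvg_le_at_highAtom (y q τ₁ τ₂ : ℝ) (M₁ M₂ j a : ℕ) (μ₂ α β : ℕ → ℝ)
    (hy0 : 0 < y) (hy1 : y < 1) (hq0 : 0 ≤ q) (hq1 : q ≤ 1)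
    (h2M : ∀ h, M₂ < h → μ₂ h = 0) (h21 : ∑ h ∈ Finset.range (M₂ + 1), μ₂ h = 1) (h20 : ∀ h, 0 ≤ μ₂ h)
    (hτ₂ : 0 < τ₂) (ha1 : 1 ≤ a) (haj : a ≤ j) (haM : a ≤ M₁) (hΔ : τ₁ ≤ 2 * (a : ℝ))
    (hD2 : DECAtT y τ₂ (j - a) M₂ (gate μ₂ q))
    (hβ : ∀ h, 0 ≤ β h)
    (hαβ : ∀ l h, l ≤ j → 2 * (l : ℝ) < τ₁ + τ₂ → h ≤ M₁ + M₂ → (j + 1 ≤ h ∨ τ₁ + τ₂ < (l : ℝ) + h) →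
      α l ≤ usage y (τ₁ + τ₂) j l h * β h) :
    ∑ k ∈ Finset.range (M₂ + 1), μ₂ k * (q * PV[(τ₁ + τ₂), j, α, β, (a + k)] + (1 - q) * PV[(τ₁ + τ₂), j, α, β, 0])
      ≤ (1 - q) * (PV[(τ₁ + τ₂), j, α, β, 0] - (if 2 * (a : ℝ) < τ₁ + τ₂ then α a else 0)) := by
  classical
  -- the pulled-back column system of `gate μ₂ q` at layer `j - a`
  set α' : ℕ → ℝ := fun k => if 2 * ((k + a : ℕ) : ℝ) < τ₂ + τ₁ then α (k + a) else 0 with hα'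
  set β' : ℕ → ℝ := fun k => β (k + a) with hβ'
  have hja : j - a + a = j := Nat.sub_add_cancel haj
  have hαβ' : ∀ l h, l ≤ j - a + a → 2 * (l : ℝ) < τ₂ + τ₁ → h ≤ M₂ + M₁ → (j - a + a + 1 ≤ h ∨ τ₂ + τ₁ < (l : ℝ) + h) →
      α l ≤ usage y (τ₂ + τ₁) (j - a + a) l h * β h := by
    intro l h hl hlow hh hc
    rw [hja] at hl hc ⊢
    rw [add_comm τ₂ τ₁] at hlow hc ⊢
    exact hαβ l h hl hlow (by omega) hc
  have hvalid := pullback_valid y τ₂ τ₁ (j - a) a M₂ M₁ α β hy0 hy1 ha1 haM hΔ hβ hαβ'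
  -- weak duality for `gate μ₂ q` at layer `j - a` with the pulled-back system
  have hβ'0 : ∀ h, 0 ≤ β' h := fun h => hβ _
  have hwd := sum_priceVec_gate_nonpos y τ₂ q (j - a) M₂ μ₂ hy0 hy1 h2M h21 hD2 α' β' hβ'0 (by
    intro l h hl hlow hh hc
    have := hvalid l h hl hlow hh hc
    simp only [hα', hβ']
    exact this)
  -- term-by-term domination: `PV[a+k] ≤ PV'[k]` for every `k`, and the zero terms differ by the price gap
  have hq0' : 0 ≤ 1 - q := by linarith
  have hterm : ∀ k, k < M₂ + 1 →
      μ₂ k * (q * PV[(τ₁ + τ₂), j, α, β, (a + k)] + (1 - q) * PV[(τ₁ + τ₂), j, α, β, 0])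
        ≤ μ₂ k * (q * PV[τ₂, (j - a), α', β', k] + (1 - q) * PV[τ₂, (j - a), α', β', 0])
          + μ₂ k * ((1 - q) * (PV[(τ₁ + τ₂), j, α, β, 0] - (if 2 * (a : ℝ) < τ₁ + τ₂ then α a else 0))) := by
    intro k _
    have hk0 : 0 ≤ μ₂ k := h20 k
    -- the zero of the column system is a low at layer `j - a` (`τ₂ > 0`) priced `α' 0 = φ⁺(a)`
    have hz : PV[τ₂, (j - a), α', β', 0] = (if 2 * (a : ℝ) < τ₁ + τ₂ then α a else 0) := by
      have h0low : (0 : ℕ) ≤ j - a ∧ 2 * ((0 : ℕ) : ℝ) < τ₂ := ⟨Nat.zero_le _, by push_cast; linarith⟩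
      rw [if_pos h0low]
      simp only [hα', zero_add]
      rw [add_comm τ₂ τ₁]
    -- the `q`-part: case analysis on the position of `k`
    have hqpart : PV[(τ₁ + τ₂), j, α, β, (a + k)] ≤ PV[τ₂, (j - a), α', β', k] := by
      by_cases hk : k ≤ j - a ∧ 2 * (k : ℝ) < τ₂
      · rw [if_pos hk]
        simp only [hα']
        rw [show k + a = a + k from Nat.add_comm k a, add_comm τ₂ τ₁]
        by_cases hpl : a + k ≤ j ∧ 2 * ((a + k : ℕ) : ℝ) < τ₁ + τ₂
        · rw [if_pos hpl, if_pos hpl.2]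
        · rw [if_neg hpl]
          have hak : a + k ≤ j := by omega
          have hn : ¬ 2 * ((a + k : ℕ) : ℝ) < τ₁ + τ₂ := fun hc => hpl ⟨hak, hc⟩
          rw [if_neg hn]
          linarith [hβ (a + k)]
      · rw [if_neg hk]
        simp only [hβ']
        rw [show k + a = a + k from Nat.add_comm k a]
        have hnl : ¬ (a + k ≤ j ∧ 2 * ((a + k : ℕ) : ℝ) < τ₁ + τ₂) := by
          rintro ⟨hak, hlow⟩
          apply hk
          refine ⟨by omega, ?_⟩
          push_cast at hlow
          linarith
        rw [if_neg hnl]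
    have h1 : μ₂ k * (q * PV[(τ₁ + τ₂), j, α, β, (a + k)]) ≤ μ₂ k * (q * PV[τ₂, (j - a), α', β', k]) :=
      mul_le_mul_of_nonneg_left (mul_le_mul_of_nonneg_left hqpart hq0) hk0
    rw [hz]
    nlinarith [h1, hk0, hq0']
  have hsum := Finset.sum_le_sum fun k hk => hterm k (Finset.mem_range.1 hk)
  rw [Finset.sum_add_distrib, ← Finset.sum_mul, h21, one_mul] at hsum
  linarith [hsum, hwd]

end LawDec

end Quant

end Summit.CriticalPhenomena.PercolationContinuityZ3.Theorems
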